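import Summits.NavierStokesRegularity.FluidComputer.AngularGalerkinLadderRadialCutoff
import Literature.Analysis.FluidPDE.ClassicalSolutionProofs

/-!
# The angular Galerkin ladder: the Galerkin defect does no work; every rung has the EXACT
# Navier–Stokes energy identity (theorems only)

Cell `ns-blowup`, seat `ns-blowup-lean` (g10). LABEL: KERNEL typing hygiene for the vocabulary of
`FluidComputer/AngularGalerkinLadder.lean` (route `Theses/AngularGalerkinLadder.lean`). WHAT THIS IS
NOT: not Navier–Stokes evidence — an orthogonality statement and the energy bookkeeping of the
truncated systems `NS_L`; nothing is asserted about blow-up or regularity of any rung, no profile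
is constructed, no crux is touched.

## Content

* `IsCobandLimited.integral_inner_eq_zero`: a co-band-limited field `g` is `L²`-orthogonal to
  every band-limited field `u` of the same degree as soon as `⟪g, u⟫` is integrable:
  `∫ ⟪g, u⟫ = 0`. Proof: by `IsCobandLimited.integral_inner_radial_smul`
  (`AngularGalerkinLadderRadialCutoff`) the pairing against the radially cut-off fields
  `χ_n(‖x‖²) u(x)`, `χ_n(s) = φ(s/(n+1))` with `φ` a smooth bump equal to `1` on `[−1, 1]`,
  vanishes for every `n`; dominated convergence (`|χ_n| ≤ 1`, `χ_n(‖x‖²) → 1`) passes to the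
  limit.
* `IsRungSolutionOn.integral_inner_defect_eq_zero`: **the Galerkin defect of a rung solution does
  no work on the velocity**: `∫ ⟪d(t), u(t)⟫ = 0` whenever the pairing is integrable.
* `IsRungSolutionOn.hasDerivWithinAt_kineticEnergy`: **the exact energy identity of every rung**
  — for a rung-`L` solution on a convex time set with uniformly rapidly decaying velocity,
  polynomially bounded pressure slice and integrable defect pairing,
  `d/dt ½‖u(t)‖₂² = −ν ‖∇u(t)‖₂²` (one-sided within the time set): the tree's forced energy
  identity `IsClassicalNSSolutionOn.hasDerivWithinAt_kineticEnergy_holds` (Majda–Bertozzi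
  Prop. 1.13; Doering–Foias (2.4)) with the work term `∫⟪d, u⟫` removed by the previous item. This
  is the structure sentence of the route text «rung solutions keep … the energy identity» as a
  kernel theorem over the typed vocabulary.

References: [cite: DoeringFoias2002, (2.4)] [cite: MajdaBertozziCUP2002, Prop. 1.13] (energy
identity); [cite: BullardGellman1954] (isotypic cut); [cite: Tao2016AveragedNS, Thm. 1.5]
(energy identity / cancellation preserved by rotation averages).
-/

noncomputable section

namespace Summit.NavierStokesRegularity.FluidComputer

open Set MeasureTheory Filter Topology Function
open scoped ContDiff RealInnerProductSpace
open Literature.Analysis.FluidPDE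

namespace AngularLadder

variable {u g : EuclideanSpace ℝ (Fin 3) → EuclideanSpace ℝ (Fin 3)} {L : ℕ}

/-- **Co-band-limited ⟂ band-limited in `L²`**: if `g` is co-band-limited and `u` band-limited of
the same degree `L`, and the pairing `⟪g, u⟫` is integrable, then `∫ ⟪g(x), u(x)⟫ dx = 0`
(radial cut-offs + dominated convergence). [folklore] -/
theorem IsCobandLimited.integral_inner_eq_zero (hg : IsCobandLimited L g) (hu : IsBandLimited L u)
    (hi : Integrable fun x => ⟪g x, u x⟫) : ∫ x, ⟪g x, u x⟫ = 0 := by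
  -- a smooth bump on `ℝ`, equal to `1` on `[-1, 1]`, supported in `(-2, 2)`
  let φ : ContDiffBump (0 : ℝ) := ⟨1, 2, one_pos, one_lt_two⟩
  -- the cut-off profiles `χ_n(s) = φ(s / (n+1))`
  let χ : ℕ → ℝ → ℝ := fun n s => φ (((n : ℝ) + 1)⁻¹ • s)
  have hχs : ∀ n, ContDiff ℝ ∞ (χ n) := fun n =>
    φ.contDiff.comp (contDiff_id.const_smul _)
  have hχc : ∀ n, HasCompactSupport (χ n) := fun n => by
    have hn : ((n : ℝ) + 1)⁻¹ ≠ 0 := inv_ne_zero (by positivity)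
    exact φ.hasCompactSupport.comp_homeomorph (Homeomorph.smulOfNeZero ((n : ℝ) + 1)⁻¹ hn)
  -- each cut-off pairing vanishes
  have hzero : ∀ n, ∫ x, ⟪g x, χ n (‖x‖ ^ 2) • u x⟫ = 0 := fun n =>
    hg.integral_inner_radial_smul hu (hχs n) (hχc n)
  -- dominated convergence
  have hF : ∀ n, (fun x => ⟪g x, χ n (‖x‖ ^ 2) • u x⟫) =
      fun x => χ n (‖x‖ ^ 2) * ⟪g x, u x⟫ := fun n => by
    funext x; rw [real_inner_smul_right]
  have hmeas : ∀ n, AEStronglyMeasurable (fun x => ⟪g x, χ n (‖x‖ ^ 2) • u x⟫) volume := by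
    intro n
    rw [hF n]
    have hc : Continuous fun x : EuclideanSpace ℝ (Fin 3) => χ n (‖x‖ ^ 2) :=
      (hχs n).continuous.comp ((continuous_norm (E := EuclideanSpace ℝ (Fin 3))).pow 2)
    exact hc.aestronglyMeasurable.mul hi.aestronglyMeasurable
  have hbound : ∀ n, ∀ᵐ x ∂(volume : Measure (EuclideanSpace ℝ (Fin 3))),
      ‖⟪g x, χ n (‖x‖ ^ 2) • u x⟫‖ ≤ ‖⟪g x, u x⟫‖ := fun n =>
    Eventually.of_forall fun x => by
      rw [real_inner_smul_right, norm_mul, Real.norm_eq_abs, abs_of_nonneg (φ.nonneg)]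
      exact mul_le_of_le_one_left (norm_nonneg (inner ℝ (g x) (u x))) φ.le_one
  have hlim : ∀ᵐ x ∂(volume : Measure (EuclideanSpace ℝ (Fin 3))),
      Tendsto (fun n => ⟪g x, χ n (‖x‖ ^ 2) • u x⟫) atTop (𝓝 ⟪g x, u x⟫) := by
    refine Eventually.of_forall fun x => ?_
    -- eventually `χ_n(‖x‖²) = 1`
    obtain ⟨N, hN⟩ := exists_nat_ge (‖x‖ ^ 2)
    refine tendsto_const_nhds.congr' (eventually_atTop.2 ⟨N, fun n hn => ?_⟩)
    have h1 : χ n (‖x‖ ^ 2) = 1 := by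
      apply φ.one_of_mem_closedBall
      rw [Metric.mem_closedBall, dist_zero_right, Real.norm_eq_abs, smul_eq_mul,
        abs_of_nonneg (mul_nonneg (inv_nonneg.2 (by positivity)) (sq_nonneg _))]
      have hn1 : (0 : ℝ) < (n : ℝ) + 1 := by positivity
      rw [inv_mul_le_iff₀ hn1, mul_one]
      calc ‖x‖ ^ 2 ≤ N := hN
        _ ≤ n := by exact_mod_cast hn
        _ ≤ (n : ℝ) + 1 := by linarith
    show ⟪g x, u x⟫ = ⟪g x, χ n (‖x‖ ^ 2) • u x⟫
    rw [h1, one_smul]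
  have hconv := tendsto_integral_of_dominated_convergence (fun x => ‖⟪g x, u x⟫‖) hmeas
    hi.norm hbound hlim
  have hconst : Tendsto (fun n : ℕ => ∫ x, ⟪g x, χ n (‖x‖ ^ 2) • u x⟫) atTop (𝓝 0) := by
    simp only [hzero]
    exact tendsto_const_nhds
  exact tendsto_nhds_unique hconv hconst

/-- **The Galerkin defect of a rung solution does no work**: for a rung-`L` solution `(u, p, d)`
on `S` and `t ∈ S` with `⟪d(t), u(t)⟫` integrable, `∫ ⟪d(t, x), u(t, x)⟫ dx = 0`. [folklore] -/
theorem IsRungSolutionOn.integral_inner_defect_eq_zero {S : Set ℝ} {ν : ℝ}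
    {v : ℝ → EuclideanSpace ℝ (Fin 3) → EuclideanSpace ℝ (Fin 3)}
    {p : ℝ → EuclideanSpace ℝ (Fin 3) → ℝ}
    {d : ℝ → EuclideanSpace ℝ (Fin 3) → EuclideanSpace ℝ (Fin 3)}
    (h : IsRungSolutionOn S ν L v p d) {t : ℝ} (ht : t ∈ S)
    (hi : Integrable fun x => ⟪d t x, v t x⟫) : ∫ x, ⟪d t x, v t x⟫ = 0 :=
  (h.2.2 t ht).integral_inner_eq_zero (h.2.1 t ht) hi

/-- **The exact energy identity of every rung of the angular Galerkin ladder**: for a rung-`L`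
solution `(u, p, d)` (viscosity `ν`) on a convex time set `S` whose velocity decays uniformly
rapidly, at a time `t ∈ S` where the pressure slice has polynomial growth and the defect pairing
`⟪d(t), u(t)⟫` is integrable, the kinetic energy `E(s) = ½ ∫‖u(s)‖²` has (one-sided, within `S`)
derivative `−ν ‖∇u(t)‖₂²` at `t` — the forced energy identity of the tree
(`IsClassicalNSSolutionOn.hasDerivWithinAt_kineticEnergy_holds`) with the work of the Galerkin
defect equal to zero. [cite: DoeringFoias2002, (2.4)] -/
theorem IsRungSolutionOn.hasDerivWithinAt_kineticEnergy {S : Set ℝ} {ν : ℝ}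
    {v : ℝ → EuclideanSpace ℝ (Fin 3) → EuclideanSpace ℝ (Fin 3)}
    {p : ℝ → EuclideanSpace ℝ (Fin 3) → ℝ}
    {d : ℝ → EuclideanSpace ℝ (Fin 3) → EuclideanSpace ℝ (Fin 3)}
    (h : IsRungSolutionOn S ν L v p d) (hS : Convex ℝ S) (hdec : HasUniformRapidDecayOn S v)
    {t : ℝ} (ht : t ∈ S) (hp : ∃ (C : ℝ) (k : ℕ), ∀ x, |p t x| ≤ C * (1 + ‖x‖) ^ k)
    (hi : Integrable fun x => ⟪d t x, v t x⟫) :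
    HasDerivWithinAt (fun s => VectorCalculus.kineticEnergy (v s))
      (-ν * VectorCalculus.gradNormSq (v t)) S t := by
  have key := IsClassicalNSSolutionOn.hasDerivWithinAt_kineticEnergy_holds h.1 hS hdec ht hp hi
  rwa [h.integral_inner_defect_eq_zero ht hi, add_zero] at key

end AngularLadder

end Summit.NavierStokesRegularity.FluidComputer

end
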